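import Mathlib
import Literature.AlgebraicGeometry.Resolution.CobordantGame
import Literature.AlgebraicGeometry.Resolution.CobordantChartCoefficients
import Summits.ResolutionOfSingularities.ResolutionOfSingularities.Theorems.WeightedInvariantLocalWeightedDropGradedGame

/-!
# `WeightedInvariant.LocalWeightedDrop`, graded game: GRADINGS PROPAGATE along graded moves

Route `ResolutionOfSingularities/WeightedInvariant`, crux `LocalWeightedDrop`
(stmt-ResolutionOfSingularities-8899).  [OURS · L1 W4.3] — item R3-T2b `successor_LHomogeneous` of
ideator res-L1-w43-idea-1's `Sketch-L1-idea-1.lean` v3 (sha16 `631198685223c190`, §5), PROVED here with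
the signature verbatim over the landed graded-game vocabulary
`Theorems/WeightedInvariantLocalWeightedDropGradedGame.lean` (`GradedGame.expVec`, `IsLHomogeneous`,
`IsLGradedMove`, `IsSuccessorAt`, `succLattice`; p498029).  res-L1-w43-plan-1 ORDER (o6) tail, CHAIN w43
v4.4.2.  Nothing here is a statement of the manuscript under review on ladder RESOLUTION.

**Statement (GRADINGS PROPAGATE).**  Let `L ⊆ ℤᵐ` be a grading lattice, `f ∈ k[[y₁..yₘ]]`
`L`-homogeneous (exponents pairwise congruent mod `L`), `(θ, w)` an `L`-graded move (every monomial
`y^e` of `θᵢ` has `e − eᵢ ∈ L`), and `g` the successor at the exceptional point `c` with exponent `a`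
(`f(θ)(cruxChart_c) = sᵃ·g`).  Then `g` is homogeneous for the successor lattice
`succLattice L w c = ⟨(w·r ; r) : r ∈ L⟩ + ⟨e_{j+1} : cⱼ ≠ 0 < wⱼ⟩ ⊆ ℤ^{m+1}`.  (`L = ⊤` is the
residue grading of `successor_graded`, file `…GradedGameResidues.lean`.)  This is the invariant that makes
the graded game `GradedWonBy` an honest game on «`L`-homogeneous germs»: positions reached by graded
moves from an `L`-homogeneous start stay homogeneous for the propagated lattice.

**Proof.**  (i) DEGREE BOOKKEEPING: say `φ` has degree `u mod L` if every exponent `e` of `φ` has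
`e − u ∈ L`.  Degrees add under products (`MvPowerSeries.coeff_mul`: a non-zero coefficient of `φψ` at
`e` has a non-zero summand at a splitting `e = e₁ + e₂`), `1` has degree `0`, powers and finite products
follow; hence `∏ᵢ θᵢ^{dᵢ}` has degree `Σ dᵢ eᵢ = d mod L`, and by `MvPowerSeries.coeff_subst` every
exponent `e` of `f(θ)` satisfies `e − d ∈ L` for some exponent `d` of `f`; with `f` `L`-homogeneous,
`f(θ)` is `L`-homogeneous (`isLHomogeneous_subst`).  (ii) CHART STEP: normalise the point (`c'ᵢ = cᵢ`
for `wᵢ > 0`, else `0`; `CobordantChart.cruxChart_eq_chart`); by `CobordantChart.coeff_cons_of_eq_X_pow_mul`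
and THE COEFFICIENT FORMULA `CobordantChart.coeff_subst_chart`, a monomial `s^r y^β` of `g` comes from an
exponent `d` of `f(θ)` with `w·d = a + r` and `dᵢ = βᵢ` off the support of `c'`
(`exists_exp_of_coeff_successor_ne_zero`).  For two monomials `(r, β)`, `(r', β')` of `g` with witnesses
`d, d'`, put `ρ = d − d' ∈ L`; then `(r − r'; β − β') − (w·ρ; ρ)` vanishes at `s` (`w·ρ = (a+r) − (a+r')`)
and at every `yⱼ` off the support of `c'`, so it is an integer combination of the unit vectors `e_{j+1}`,
`cⱼ ≠ 0 < wⱼ`; both pieces are generators of `succLattice L w c`.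
-/

set_option linter.dupNamespace false -- mandated namespace of this single-conjunct summit
set_option autoImplicit false

namespace Summit.ResolutionOfSingularities.ResolutionOfSingularities.Theorems

namespace GradedGame

open MvPowerSeries
open Literature.AlgebraicGeometry.Resolution

variable {k : Type} [Field k]

section Degree

variable {m : ℕ} (L : AddSubgroup (Fin m → ℤ))

/-- `expVec` is additive. [OURS · L1 W4.3] -/
theorem expVec_add (e e' : Fin m →₀ ℕ) : expVec (e + e') = expVec e + expVec e' := by
  funext i
  simp [expVec]

/-- `expVec 0 = 0`. [OURS · L1 W4.3] -/
theorem expVec_zero : expVec (0 : Fin m →₀ ℕ) = 0 := by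
  funext i
  simp [expVec]

/-- `Σᵢ dᵢ • eᵢ = d` as integer vectors. [OURS · L1 W4.3] -/
theorem sum_smul_single_eq_expVec (d : Fin m →₀ ℕ) :
    ∑ i : Fin m, d i • (Pi.single i (1 : ℤ) : Fin m → ℤ) = expVec d := by
  funext j
  rw [Finset.sum_apply]
  simp only [Pi.smul_apply, Pi.single_apply, smul_ite, smul_zero, nsmul_eq_mul, mul_one,
    Finset.sum_ite_eq, Finset.mem_univ, if_true, expVec]

/-- DEGREES ADD: if every exponent of `φ` is `≡ u` and every exponent of `ψ` is `≡ v (mod L)`, then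
every exponent of `φ·ψ` is `≡ u + v (mod L)`. [OURS · L1 W4.3] -/
theorem homDeg_mul {u v : Fin m → ℤ} {φ ψ : MvPowerSeries (Fin m) k}
    (hφ : ∀ e, coeff e φ ≠ 0 → expVec e - u ∈ L) (hψ : ∀ e, coeff e ψ ≠ 0 → expVec e - v ∈ L) :
    ∀ e, coeff e (φ * ψ) ≠ 0 → expVec e - (u + v) ∈ L := by
  intro e he
  rw [coeff_mul] at he
  obtain ⟨q, hq, hne⟩ := Finset.exists_ne_zero_of_sum_ne_zero he
  have hq : q.1 + q.2 = e := by simpa using hq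
  have h1 := hφ q.1 (left_ne_zero_of_mul hne)
  have h2 := hψ q.2 (right_ne_zero_of_mul hne)
  have he' : expVec e = expVec q.1 + expVec q.2 := by rw [← hq, expVec_add]
  have hsplit : expVec e - (u + v) = (expVec q.1 - u) + (expVec q.2 - v) := by
    rw [he']
    abel
  rw [hsplit]
  exact L.add_mem h1 h2

/-- `1` has degree `0`. [OURS · L1 W4.3] -/
theorem homDeg_one : ∀ e, coeff e (1 : MvPowerSeries (Fin m) k) ≠ 0 → expVec e - 0 ∈ L := by
  intro e he
  rw [coeff_one] at he
  by_cases h0 : e = 0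
  · subst h0
    rw [expVec_zero, sub_zero]
    exact L.zero_mem
  · exact absurd (if_neg h0) he

/-- POWERS: `φ^n` has degree `n • u`. [OURS · L1 W4.3] -/
theorem homDeg_pow {u : Fin m → ℤ} {φ : MvPowerSeries (Fin m) k}
    (hφ : ∀ e, coeff e φ ≠ 0 → expVec e - u ∈ L) :
    ∀ (n : ℕ) (e : Fin m →₀ ℕ), coeff e (φ ^ n) ≠ 0 → expVec e - n • u ∈ L := by
  intro n
  induction n with
  | zero =>
    intro e he
    rw [pow_zero] at he
    rw [zero_smul]
    exact homDeg_one L e he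
  | succ n ih =>
    intro e he
    rw [pow_succ] at he
    rw [add_smul, one_smul]
    exact homDeg_mul L ih hφ e he

/-- FINITE PRODUCTS: degrees add. [OURS · L1 W4.3] -/
theorem homDeg_prod {ι : Type} [DecidableEq ι] (s : Finset ι) (u : ι → Fin m → ℤ)
    (φ : ι → MvPowerSeries (Fin m) k)
    (hφ : ∀ i ∈ s, ∀ e, coeff e (φ i) ≠ 0 → expVec e - u i ∈ L) :
    ∀ e, coeff e (∏ i ∈ s, φ i) ≠ 0 → expVec e - ∑ i ∈ s, u i ∈ L := by
  induction s using Finset.induction_on with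
  | empty =>
    intro e he
    rw [Finset.prod_empty] at he
    rw [Finset.sum_empty]
    exact homDeg_one L e he
  | insert i s hi ih =>
    intro e he
    rw [Finset.prod_insert hi] at he
    rw [Finset.sum_insert hi]
    exact homDeg_mul L (hφ i (Finset.mem_insert_self i s))
      (ih fun j hj => hφ j (Finset.mem_insert_of_mem hj)) e he

/-- SUBSTITUTION: under an `L`-graded move, every exponent `e` of `f(θ)` is congruent mod `L` to some
exponent `d` of `f` (`∏ᵢ θᵢ^{dᵢ}` has degree `d`). [OURS · L1 W4.3] -/
theorem exists_exp_of_coeff_subst_ne_zero {θ : Fin m → MvPowerSeries (Fin m) k} {w : Fin m → ℕ}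
    (hθ : IsLGradedMove L θ w) (f : MvPowerSeries (Fin m) k) (e : Fin m →₀ ℕ)
    (he : coeff e (subst θ f) ≠ 0) :
    ∃ d : Fin m →₀ ℕ, coeff d f ≠ 0 ∧ expVec e - expVec d ∈ L := by
  classical
  have hs : HasSubst θ := hasSubst_of_constantCoeff_zero fun i => hθ.1.1 i
  rw [coeff_subst hs] at he
  obtain ⟨d, hd⟩ := not_forall.mp (mt finsum_eq_zero_of_forall_eq_zero he)
  rw [smul_eq_mul] at hd
  refine ⟨d, left_ne_zero_of_mul hd, ?_⟩
  have hprod : coeff e (d.prod fun i n => θ i ^ n) ≠ 0 := right_ne_zero_of_mul hd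
  rw [Finsupp.prod_fintype _ _ (fun i => pow_zero _)] at hprod
  have key := homDeg_prod L Finset.univ (fun i => d i • (Pi.single i (1 : ℤ) : Fin m → ℤ))
    (fun i => θ i ^ d i) (fun i _ => homDeg_pow L (hθ.2 i) (d i)) e hprod
  rwa [sum_smul_single_eq_expVec] at key

/-- An `L`-graded move preserves `L`-homogeneity: `f` `L`-homogeneous ⇒ `f(θ)` `L`-homogeneous.
[OURS · L1 W4.3] -/
theorem isLHomogeneous_subst {θ : Fin m → MvPowerSeries (Fin m) k} {w : Fin m → ℕ}
    (hθ : IsLGradedMove L θ w) {f : MvPowerSeries (Fin m) k} (hf : IsLHomogeneous L f) :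
    IsLHomogeneous L (subst θ f) := by
  intro e e' he he'
  obtain ⟨d, hd, hed⟩ := exists_exp_of_coeff_subst_ne_zero L hθ f e he
  obtain ⟨d', hd', hed'⟩ := exists_exp_of_coeff_subst_ne_zero L hθ f e' he'
  have hdd' := hf d d' hd hd'
  have hsplit : expVec e - expVec e' =
      (expVec e - expVec d) + (expVec d - expVec d') - (expVec e' - expVec d') := by
    abel
  rw [hsplit]
  exact L.sub_mem (L.add_mem hed hdd') hed'

end Degree

section Chart

variable {m : ℕ}

/-- CHART STEP: a monomial `s^{e₀} y^{(e₁..)}` of the successor `g` (`F(cruxChart_c) = sᵃ·g`) comes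
from an exponent `d` of `F` with `w·d = a + e₀` and `dⱼ = e_{j+1}` for every `j` off the support of
the normalised point (`¬ (cⱼ ≠ 0 ∧ 0 < wⱼ)`).  From THE COEFFICIENT FORMULA
`CobordantChart.coeff_subst_chart`. [OURS · L1 W4.3] -/
theorem exists_exp_of_coeff_successor_ne_zero (F : MvPowerSeries (Fin m) k) (w : Fin m → ℕ)
    (c : Fin m → k) (a : ℕ) (g : MvPowerSeries (Fin (m + 1)) k)
    (hfac : subst (CobordantGame.cruxChart k w c) F = X (0 : Fin (m + 1)) ^ a * g)
    (e : Fin (m + 1) →₀ ℕ) (he : coeff e g ≠ 0) :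
    ∃ d : Fin m →₀ ℕ, coeff d F ≠ 0 ∧ Finsupp.weight w d = a + e 0 ∧
      ∀ j, ¬ (c j ≠ 0 ∧ 0 < w j) → d j = e j.succ := by
  classical
  -- normalise the point
  set c' : Fin m → k := fun i => if 0 < w i then c i else 0 with hc'def
  have hcc : CobordantGame.cruxChart k w c = CobordantChart.chart w c' :=
    CobordantChart.cruxChart_eq_chart w c
  rw [hcc] at hfac
  have hconv : ∀ i, w i = 0 → c' i = 0 := fun i hi => by simp [hc'def, hi]
  -- write `e = (r, β)`
  obtain ⟨r, β, rfl⟩ : ∃ (r : ℕ) (β : Fin m →₀ ℕ), e = Finsupp.cons r β :=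
    ⟨e 0, Finsupp.tail e, (Finsupp.cons_tail e).symm⟩
  simp only [Finsupp.cons_zero, Finsupp.cons_succ]
  -- the coefficient of `s^r y^β` in `g` is the coefficient formula at `s^{a+r} y^β`
  rw [CobordantChart.coeff_cons_of_eq_X_pow_mul hfac, CobordantChart.coeff_subst_chart w c' hconv] at he
  obtain ⟨d, hd⟩ := not_forall.mp (mt finsum_eq_zero_of_forall_eq_zero he)
  obtain ⟨hwd, hd⟩ := ite_ne_right_iff.mp hd
  have hfac' : ∀ i, ((d i).choose (β i) : k) * c' i ^ (d i - β i) ≠ 0 := fun i =>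
    Finset.prod_ne_zero_iff.mp (mul_ne_zero_iff.mp hd).2 i (Finset.mem_univ i)
  refine ⟨d, (mul_ne_zero_iff.mp hd).1, hwd, fun j hj => ?_⟩
  -- off the support of `c'` the exponent is forced
  have hcj : c' j = 0 := by
    by_cases hw : 0 < w j
    · have hc0 : c j = 0 := by
        by_contra hc0
        exact hj ⟨hc0, hw⟩
      simp [hc'def, hw, hc0]
    · simp [hc'def, hw]
  have h := hfac' j
  rw [hcj] at h
  by_contra hne
  rcases Nat.lt_or_gt_of_ne hne with hlt | hgt
  · exact h (by rw [Nat.choose_eq_zero_of_lt hlt, Nat.cast_zero, zero_mul])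
  · exact h (by rw [zero_pow (Nat.sub_ne_zero_of_lt hgt), mul_zero])

/-- The weight of an exponent as an integer sum. [OURS · L1 W4.3] -/
theorem weight_cast_eq_sum (w : Fin m → ℕ) (d : Fin m →₀ ℕ) :
    ((Finsupp.weight w d : ℕ) : ℤ) = ∑ j, (w j : ℤ) * (d j : ℤ) := by
  rw [Finsupp.weight_apply, Finsupp.sum_fintype _ _ (fun _ => by simp)]
  simp only [smul_eq_mul]
  push_cast
  exact Finset.sum_congr rfl fun j _ => mul_comm _ _

/-- R3-T2b — GRADINGS PROPAGATE (class level, elementary): an `L`-homogeneous position moved by an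
`L`-graded move has `succLattice`-homogeneous successors.  (`L = ⊤`: the residue grading of
`successor_graded`.) [OURS · L1 W4.3, Sketch-L1-idea-1 v3 §5, signature verbatim] -/
theorem successor_LHomogeneous (L : AddSubgroup (Fin m → ℤ)) (f : MvPowerSeries (Fin m) k)
    (hf : IsLHomogeneous L f) (θ : Fin m → MvPowerSeries (Fin m) k) (w : Fin m → ℕ)
    (hθ : IsLGradedMove L θ w) (c : Fin m → k) (a : ℕ) (g : MvPowerSeries (Fin (m + 1)) k)
    (hg : IsSuccessorAt f θ w c a g) :
    IsLHomogeneous (succLattice L w c) g := by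
  classical
  have hF : IsLHomogeneous L (subst θ f) := isLHomogeneous_subst L hθ hf
  obtain ⟨-, hfac, -, -⟩ := hg
  intro e e' he he'
  obtain ⟨d, hd, hwd, hdj⟩ := exists_exp_of_coeff_successor_ne_zero (subst θ f) w c a g hfac e he
  obtain ⟨d', hd', hwd', hdj'⟩ := exists_exp_of_coeff_successor_ne_zero (subst θ f) w c a g hfac e' he'
  -- `ρ = d − d' ∈ L` and the first generator `(w·ρ ; ρ)`
  have hρL : expVec d - expVec d' ∈ L := hF d d' hd hd'
  have hv₁ : (Matrix.vecCons (∑ j, (w j : ℤ) * (expVec d - expVec d') j) (expVec d - expVec d') :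
      Fin (m + 1) → ℤ) ∈ succLattice L w c :=
    AddSubgroup.subset_closure (Or.inl ⟨expVec d - expVec d', hρL, rfl⟩)
  -- the defect `δ = (e − e') − (w·ρ ; ρ)`
  set δ : Fin (m + 1) → ℤ := expVec e - expVec e' -
    Matrix.vecCons (∑ j, (w j : ℤ) * (expVec d - expVec d') j) (expVec d - expVec d') with hδ
  have hw₁ : ∑ j, (w j : ℤ) * ((d j : ℤ) - (d' j : ℤ)) = ((a : ℤ) + (e 0 : ℤ)) - ((a : ℤ) + (e' 0 : ℤ)) := by
    have h1 := weight_cast_eq_sum w d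
    have h2 := weight_cast_eq_sum w d'
    rw [hwd] at h1
    rw [hwd'] at h2
    push_cast at h1 h2
    rw [h1, h2, ← Finset.sum_sub_distrib]
    exact Finset.sum_congr rfl fun j _ => by ring
  have hδ0 : δ 0 = 0 := by
    have h0 : δ 0 = (e 0 : ℤ) - (e' 0 : ℤ) - ∑ j, (w j : ℤ) * ((d j : ℤ) - (d' j : ℤ)) := by
      simp only [hδ, Pi.sub_apply, Matrix.cons_val_zero, expVec]
    rw [h0, hw₁]
    ring
  have hδsucc : ∀ j, ¬ (c j ≠ 0 ∧ 0 < w j) → δ j.succ = 0 := by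
    intro j hj
    have h1 : δ j.succ = (e j.succ : ℤ) - (e' j.succ : ℤ) - ((d j : ℤ) - (d' j : ℤ)) := by
      simp only [hδ, Pi.sub_apply, Matrix.cons_val_succ, expVec]
    rw [h1, hdj j hj, hdj' j hj]
    ring
  -- `δ` is an integer combination of the unit vectors `e_{j+1}`, `cⱼ ≠ 0 < wⱼ`
  have hδmem : δ ∈ succLattice L w c := by
    rw [← Finset.univ_sum_single δ]
    refine AddSubgroup.sum_mem _ fun i _ => ?_
    refine Fin.cases ?_ (fun j => ?_) i
    · rw [hδ0, Pi.single_zero]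
      exact AddSubgroup.zero_mem _
    · by_cases hj : c j ≠ 0 ∧ 0 < w j
      · have hgen : (Pi.single j.succ (1 : ℤ) : Fin (m + 1) → ℤ) ∈ succLattice L w c :=
          AddSubgroup.subset_closure (Or.inr ⟨j, hj.1, hj.2, rfl⟩)
        have hsm : (Pi.single j.succ (δ j.succ) : Fin (m + 1) → ℤ) =
            δ j.succ • (Pi.single j.succ (1 : ℤ) : Fin (m + 1) → ℤ) := by
          funext l
          by_cases hl : l = j.succ
          · subst hl
            simp
          · simp [hl]
        rw [hsm]
        exact AddSubgroup.zsmul_mem _ hgen _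
      · rw [hδsucc j hj, Pi.single_zero]
        exact AddSubgroup.zero_mem _
  have hsplit : expVec e - expVec e' =
      Matrix.vecCons (∑ j, (w j : ℤ) * (expVec d - expVec d') j) (expVec d - expVec d') + δ := by
    simp only [hδ]
    abel
  rw [hsplit]
  exact AddSubgroup.add_mem _ hv₁ hδmem

end Chart

section TopStart

/-! ### The start of the graded game: `L = ⊤` (no grading)

Appended glue (rev 2): at `L = ⊤` every germ is homogeneous and every legal move is graded, and a
singular successor of the plain game `CobordantGame.IsSuccessor` is an `IsSuccessorAt` at some `(c, a)`;
hence EVERY successor of EVERY move is homogeneous for `succLattice ⊤ w c` (the residue grading of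
`…GradedGameResidues.lean`), which is where a graded-game strategy starts its induction. -/

variable {m : ℕ}

/-- Every germ is `⊤`-homogeneous. [OURS · L1 W4.3] -/
theorem isLHomogeneous_top (f : MvPowerSeries (Fin m) k) : IsLHomogeneous ⊤ f :=
  fun _ _ _ _ => AddSubgroup.mem_top _

/-- At `L = ⊤` a graded move is just a legal move. [OURS · L1 W4.3] -/
theorem isLGradedMove_top_iff (θ : Fin m → MvPowerSeries (Fin m) k) (w : Fin m → ℕ) :
    IsLGradedMove ⊤ θ w ↔ CobordantGame.IsMove k θ w :=
  ⟨fun h => h.1, fun h => ⟨h, fun _ _ _ => AddSubgroup.mem_top _⟩⟩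

/-- The plain game's singular successors are the `IsSuccessorAt` at some exceptional point `c` and
exponent `a` (definitional unfolding). [OURS · L1 W4.3] -/
theorem isSuccessor_iff_exists_isSuccessorAt (f : MvPowerSeries (Fin m) k)
    (θ : Fin m → MvPowerSeries (Fin m) k) (w : Fin m → ℕ) (g : MvPowerSeries (Fin (m + 1)) k) :
    CobordantGame.IsSuccessor k f θ w g ↔ ∃ (c : Fin m → k) (a : ℕ), IsSuccessorAt f θ w c a g :=
  Iff.rfl

/-- START OF THE GRADED GAME: every successor of every legal move, at the exceptional point `c`, is
homogeneous for the residue lattice `succLattice ⊤ w c`. [OURS · L1 W4.3] -/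
theorem successor_LHomogeneous_top (f : MvPowerSeries (Fin m) k) (θ : Fin m → MvPowerSeries (Fin m) k)
    (w : Fin m → ℕ) (hθ : CobordantGame.IsMove k θ w) (c : Fin m → k) (a : ℕ)
    (g : MvPowerSeries (Fin (m + 1)) k) (hg : IsSuccessorAt f θ w c a g) :
    IsLHomogeneous (succLattice ⊤ w c) g :=
  successor_LHomogeneous ⊤ f (isLHomogeneous_top f) θ w ((isLGradedMove_top_iff θ w).mpr hθ) c a g hg

end TopStart

end GradedGame

end Summit.ResolutionOfSingularities.ResolutionOfSingularities.Theorems
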